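import Literature.MathematicalPhysics.QuantumFieldTheory.Balaban1983to89.B8Prop5SocketDatumSrc
import Literature.MathematicalPhysics.QuantumFieldTheory.Balaban1983to89.B8Eq142KLevelLocalGamma
import Literature.MathematicalPhysics.QuantumFieldTheory.Balaban1983to89.B8Prop3GaugeFixedKLevelSrcGamma

/-!
# `Balaban1983to89.B8Prop5SocketDatumSrcGamma` — [Balaban1985RegularSpaces] (1.69) from (1.67)–(1.68) by PROPOSITION 3 AT LEVEL `m`, WITH A SOURCE,
# EDITION γ — PRINT's BOX LAW «the box of a level-j datum bond lies in Ω_{j−1}» ((1.31) p. 82) for the class read by the sourced b9 socket, and (1.35) in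
# the p. 77 convention; dag-n05-d's `B8Prop5SocketDatumSrc.grad_bound_of_datum_src` re-assembled on dag-n05-e's `H42_of_inAx_γ` and dag-n05-d's
# `B8Prop3GaugeFixedKLevelSrcGamma.prop3_normA_kLevel_src_γ`

statement-level skeleton of published theorems with citation tags; proofs where landed; nothing here is a claim about the Yang–Mills mass gap

T. Bałaban, *Spaces of regular gauge field configurations on a lattice and gauge fixing conditions*, Commun. Math. Phys. **99** (1985) 75–102
`[Balaban1985RegularSpaces]` ("B8"; printed page = PDF page + 74): (1.67)–(1.69) p. 88, Prop. 3 p. 87, (1.40)–(1.42) p. 83, (1.31) + (1.35) p. 82, p. 77,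
(1.55)–(1.62) pp. 86–87, Thm 8 (1.146) p. 101 («Inspecting the proofs … only some constants change»); [3] = [Balaban1985Averaging] Prop. 4 p. 38;
[4] = [Balaban1985BackgroundPropagators] Thm 3.3 p. 398.  PDF held: `paper:balaban1985-cmp99-regular-spaces-gauge-fixing`.  STATUS: published, refereed.

CITATION HEADER (lean-in-tree rule).  Cell `pub-ymgap` (YM Track A, DAG node N05 = [B8], HUMAN RULING D-0062 ∕ D-0149 width seats), seat
`pub-ymgap-dag-n05-w4` (g0): the sourced Prop-5 socket twins HANDED OVER by dag-n05-d g10 (cell bus 2026-08-27, l.24117) under W-SEAT-START-LIST v3 §n05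
item 4 («the Prop-5 sockets, m ≥ 1 obligation»).  WHY THIS FILE.  The SOURCED road of record (Theorem 8's gauge condition (1.146); dag-n05-d g5
`B8SockHFPRDSrc`, `B8SockP5uEAssemblyBSrc`, `B8SockSP5*Src`) takes the size of the source term `D*A′` from dag-n05-d's `B8Prop5SocketDatumSrc.grad_bound_of_datum_src`,
which reads the knit's class∕law∕socket binders «`hbox` : box ⊂ Ω_j», `hclass`, (1.35) `h135` and the two sourced (1.59) lines over the class `Λb m` through the
(1.42) LEMMA `B8Eq142KLevelLocal.H42_of_inAx` and n05-c g4's sourced Proposition 3 `B8Prop3GaugeFixedKLevelSrc.prop3_normA_kLevel_src` — the «box ⊂ Ω_j»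
configuration certified UNSATISFIABLE at nested members (dag-n05-c p572834 ∕ p576185; dag-n05-d p585094).  Both inputs have editions γ under print's law
«box ⊂ Ω_{j−1}» (dag-n05-e `B8Eq142KLevelLocalGamma.H42_of_inAx_γ`; dag-n05-d D7-1 `B8Prop3GaugeFixedKLevelSrcGamma.prop3_normA_kLevel_src_γ`).  THIS FILE is the
edition γ of the sourced datum theorem: ★ `grad_bound_of_datum_src_γ` = `grad_bound_of_datum_src` with `hbox` AND `h135` guarded by «box ⊂ Ω_{j−1}» (ℕ
subtraction; level 0 reads `Ω₀`), the [3]-Prop.-4 windows of the (1.42)∕(1.56) steps at `(L²α₀, L·α₂)` (`hα3 hα4 h16L hsmall hc₃`), the (1.56) remainder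
constant `C₂ ≥ 8·131072(d+1)²·e^{4c·L²α₀}·L²`; the two calls re-pointed; everything else VERBATIM (un-sourced twin: this seat's
`B8Prop5SocketDatumGamma.grad_bound_of_datum_γ`, p584536).  Kind «kernel-checked proof», one theorem, no `def`, no existing module modified.

HONEST SCOPE ∕ A6.  One print-located estimate re-run by name; 0 new estimates.  The two sourced (1.59) lines `h59a h59g` are HYPOTHESES over the PARAMETRIC
class `Λb` ([4] Thm 3.3 + (1.57)–(1.58) for the sourced condition = the knit's `SH59src` at this datum — false over a «box ⊂ Ω_j» class at nested members; =
print's (1.59) over print's class `cubeLamBP'` ∕ `towerBondsP`, open; N06 content at `m ≥ 1`).  No satisfiability claim is made here.  The datum hypotheses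
(1.33)∕(1.34)∕axial∕(1.35) are Theorem 4's frame; `Lan` is abstract.  Windows displayed, not discharged; `d ≥ 2`, `L ≥ 2`; `T_η ↦ ℤᵈ`.  Count-neutral; N05 NOT
discharged; no count claim; one finite `𝕋⁴` programme at fixed `ε`, Bałaban as printed; the Yang–Mills mass gap (Clay) is NOT proved by any of this — R4 closes
the conditional finite-`𝕋⁴` rung `BalabanLadder.UV` only; nothing continuum ∕ ℝ⁴ ∕ OS.  No `sorry`, no `def`, no `instance`, no `notation`.
Unit `pub-ymgap-dag-n05-w4` (g0), 2026-08-28.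

RELATED IN THE TREE, NOT DUPLICATED: `B8Prop5SocketDatumSrc` (dag-n05-d; the «box ⊂ Ω_j» edition), `B8Prop5SocketDatumGamma` (this seat; un-sourced γ twin),
`B8Prop3GaugeFixedKLevelSrcGamma` (dag-n05-d; USED), `B8Eq142KLevelLocalGamma` (dag-n05-e; USED), `B8SockP5uEAssemblyBSrc` ∕ `B8SockHFPRDSrc` (dag-n05-d; the
consumers whose editions γ follow).
-/

noncomputable section


open NormedSpace
open scoped BigOperators

namespace Literature.MathematicalPhysics.QuantumFieldTheory.Balaban1983to89.B8Prop5SocketDatumSrcGamma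

open Complex (I)
open B7Prop1Explicit B7Prop2Explicit B7Prop1Local B7Eq92Concrete
open B7Prop2Explicit (C0 c2')
open B7Prop3Flat (c3)
open B7Eq78Linearization (conjR conjR_sub conjR_smul_real)
open B8Ineq132 (covDerivFwd covDeriv InAk BondTouches Under norm_conjR conjR_conjR one_conjR)
open B8Eq119TwistedAxial (Restr129 InAx inAx_iff)
open B8Eq184Proof (cfgExp)
open B8Lemma1NonAbelian (mulCfg)
open B8Eq140Level (SideTouches sideTouches_of_bondTouches)
open B8Eq146AExpansion (iEta expCfg)
open B7Prop4GeneralLevels (logCovIter linCovIter)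
open B8Eq155JBound (Jcur wsup expCfg_iEta_mem_unitaryUnits)
open B8ScaledSupNorm (bondNorm msup weight Bdd)
open B8Ineq130 (tlo thi block_mem smul_mem inBox_of_le axialFn_congr agree_level)
open B8Thm2LogB (blockTop)
open B8Eq138LandauZd (covDivB covLap)
open B8Prop3GaugeFixedKLevel (mem_unitaryUnits_of_mgauge_eq mulCfg_eq_gaugeAct_of_mgauge_eq inAk_congr_of_sideTouches
  expCfg_iEta_eq_cfgExp cfgExp_congr_at)
open B8Prop3GaugeFixedKLevelSrc (prop3_normA_kLevel_src)
open B8Prop5SocketDatum (grad_bound_trivial)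
open B8Prop5ContractionKLevel (Bd2)
open B8LambdaSpaceKLevel (wt)

-- `Site` alone could resolve to the torus sites of `Setup.lean`; re-export the `ℤ^d` sites of `B7Prop1Explicit`.
export B7Prop1Explicit (Site)

variable {d : ℕ}

section Grad

variable {𝔸 : Type*} [CStarAlgebra 𝔸] [Nontrivial 𝔸]

/-- ★ **(1.69) FROM (1.67)–(1.68) BY PROPOSITION 3 AT LEVEL `m ≥ 1`, WITH A SOURCE, EDITION γ — PRINT's BOX LAW «box ⊂ Ω_{j−1}», (1.35) IN THE p. 77 GUARD** (`hbox`∕`h135` at `Ω (j − 1)`; windows at `(L²α₀, L·α₂)`; `C₂` L²-scaled; (1.42) by dag-n05-e's `H42_of_inAx_γ`, Prop. 3 with source by dag-n05-d's `prop3_normA_kLevel_src_γ`) — otherwise `B8Prop5SocketDatum.grad_bound_of_datum` re-run for a datum in an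
ABSTRACT gauge predicate `Lan m U₁` (Theorem 8: (1.146) with source `f`) and with the two (1.59)-lines WITH SOURCE (`+ Sa`, `+ Sg`; [4] Thm 3.3 + (1.57)–(1.58)
for the sourced condition — the knit's `SH59src` at this datum) as displayed inputs: `(Lʲη)²|(∇^η_{U₀,κ}A′_τ)(y)| ≤ 5dLB₀(α₀ + α₁) + 2·Sg` on every side of
a plaquette touching `Ω_j`, `j ≤ m`.  Proof by name: (1.40)₁ for `e^{iηA′}U₀` by gauge invariance and locality; (1.42) on `Λb m` by `H42_of_inAx` at `Lan`;
n05-c g4's `prop3_normA_kLevel_src` on the bounded gradient family. [cite: Balaban1985RegularSpaces, (1.67)–(1.69) p.88, Prop. 3 p.87, (1.40)–(1.42) p.83, (1.59)–(1.62) pp.86–87, Thm 8 (1.146) p.101] -/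
theorem grad_bound_of_datum_src_γ (hd2 : 2 ≤ d) {η : ℝ} (hη : 0 < η) {L : ℕ} (hL : 2 ≤ L) (K : ℕ)
    {U₀ U' : Site d → Fin d → 𝔸ˣ} (hU₀ : ∀ x κ, U₀ x κ ∈ unitaryUnits 𝔸) (hU' : ∀ x κ, U' x κ ∈ unitaryUnits 𝔸)
    {α₀ α₁ α₂ B₀ C₂ : ℝ} (hα₀ : 0 < α₀) (hα₁ : 0 < α₁) (hα₂ : 0 < α₂) (hB₀ : 0 ≤ B₀)
    -- Prop. 3's windows at `(α₀, α₂)` (cf. `B8LeafModelZd3.prop3_windows`), (1.61), and `dLα₁ ≤ 1/8`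
    -- EDITION γ: [3] Prop. 4's windows of the (1.42)∕(1.56) steps ONE LEVEL LOWER, at `(L²α₀, Lα₂)`
    (hα3 : C0 d * ((L : ℝ) ^ 2 * α₀) ≤ 1 / 3) (hα4 : 4 * ((L : ℝ) ^ 2 * α₀) ≤ c2' d L) (h16L : 16 * ((L : ℝ) * α₂) ≤ 1)
    (hd5 : 5 * α₂ * ((d : ℝ) - 1) ≤ 4)
    (hsmall : Real.exp (4 * (800 * ((d : ℝ) + 1) ^ 2 * ((d : ℝ) + 4)) * ((L : ℝ) ^ 2 * α₀))
      * (1 + 8 * (131072 * ((d : ℝ) + 1) ^ 2) * ((L : ℝ) * α₂)) ≤ 2)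
    (hc₃ : 2 * ((L : ℝ) * α₂) ≤ c3 d L) (hside : 36 * d * B₀ * α₂ ≤ 1 / 2) (h50 : 50 * d * α₂ ≤ 1)
    (hC₂ : 8 * (131072 * ((d : ℝ) + 1) ^ 2) * Real.exp (4 * (800 * ((d : ℝ) + 1) ^ 2 * ((d : ℝ) + 4)) * ((L : ℝ) ^ 2 * α₀))
      * (L : ℝ) ^ 2 ≤ C₂)
    (h61 : 2 * α₂ ^ 2 + 20 * d * α₀ * α₂ + 2 * C₂ * α₂ ^ 2 ≤ α₀ + α₁) (hsmall₁ : (d : ℝ) * L * α₁ ≤ 1 / 8)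
    -- the member's geometry
    (Ω : ℕ → Set (Site d)) (hΩ : ∀ j, Ω (j + 1) ⊆ Ω j) (Λs : ℕ → ℕ → Set (Site d)) (Λb : ℕ → ℕ → Set (Site d × Fin d))
    -- PRINT's box law: the locality box of a datum bond of level `j` lies in `Ω_{j−1}` ((1.31); level 0: `Ω₀`)
    (hbox : ∀ m, m ≤ K → ∀ j, j ≤ m → ∀ c ∈ Λb m j, ∀ x, InBox (loK L j c.1) (bondHiK L j c.1 c.2) x → x ∈ Ω (j - 1))
    (hclass : ∀ m, m ≤ K → ∀ j, j ≤ m → ∀ c ∈ Λb m j,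
      (c.1 ∈ Λs m j ∧ c.1 + e c.2 ∈ Λs m j) ∨
      (∃ j', j = j' + 1 ∧ (∀ x, (L : ℤ) • c.1 ≤ x → x ≤ (L : ℤ) • c.1 + blockTop L → x ∈ Λs m j') ∧ c.1 + e c.2 ∈ Λs m j) ∨
      (∃ j', j = j' + 1 ∧ c.1 ∈ Λs m j ∧ (∀ x, (L : ℤ) • (c.1 + e c.2) ≤ x → x ≤ (L : ℤ) • (c.1 + e c.2) + blockTop L → x ∈ Λs m j')))
    -- the socket's antecedents: (1.33), (1.34), (1.35)/(1.66)
    (h33 : InAk L K η α₀ Ω U₀) (h34 : InAk L K η α₀ Ω (mulCfg U' U₀)) (hAx : ∀ m, m ≤ K → InAx L m (Λs m) U₀ (mulCfg U' U₀))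
    (h135 : ∀ j, j ≤ K → ∀ (z : Site d) (μ : Fin d), (∀ x, InBox (loK L j z) (bondHiK L j z μ) x → x ∈ Ω (j - 1)) →
      ‖(avgIter L (mulCfg U' U₀) j z μ : 𝔸) - (avgIter L U₀ j z μ : 𝔸)‖ ≤ α₁)
    -- the datum at level `m` (`1 ≤ m ≤ K`), with its masked exponent, in the gauge predicate `Lan m` (any family: the (1.42) lemma reads it abstractly)
    {m : ℕ} (hm1 : 1 ≤ m) (hmK : m ≤ K) (Lan : ℕ → (Site d → Fin d → 𝔸ˣ) → Prop)
    {u₁ : Site d → 𝔸ˣ} {U₁ : Site d → Fin d → 𝔸ˣ} {A' : Site d → Fin d → 𝔸}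
    (hu₁ : ∀ x, u₁ x ∈ unitaryUnits 𝔸) (hW : mgauge U₀ u₁ U₁ = U') (h129 : Restr129 L m (Λs m) U₀ u₁)
    (hLan : Lan m U₁) (hsa : ∀ y τ, IsSelfAdjoint (A' y τ))
    (hWA : ∀ j, j ≤ m → ∀ (y : Site d) (τ : Fin d), SideTouches (Ω j) y τ →
      U₁ y τ = cfgExp η A' y τ ∧ ‖A' y τ‖ ≤ α₂ * ((L : ℝ) ^ j * η)⁻¹)
    (hA0 : ∀ (y : Site d) (τ : Fin d), (∀ j, j ≤ m → ¬ SideTouches (Ω j) y τ) → A' y τ = 0)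
    -- THE TWO (1.59)-LINES WITH SOURCE for the masked exponent at level `m` ([4] Thm 3.3 + (1.57)–(1.58) for the SOURCED gauge condition: what the
    -- knit's sourced b9 socket `SH59src` delivers at this datum; source terms `Sa`, `Sg`)
    {Sa Sg : ℝ}
    (h59a : msup L m η (-(1 : ℝ)) (fun j (b : Site d × Fin d) => SideTouches (Ω j) b.1 b.2) (fun b => A' b.1 b.2)
        ≤ B₀ * (bondNorm L m η (-(3 : ℝ)) Ω (fun x μ => Jcur η U₀ A' μ x)
        + wsup 1 (fun p : {p : ℕ × (Site d × Fin d) // p.1 ≤ m ∧ p.2 ∈ Λb m p.1} =>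
        linCovIter L U₀ (iEta η A') p.1.1 p.1.2.1 p.1.2.2)) + Sa)
    (h59g : msup L m η (-(2 : ℝ)) (fun j (t : Fin d × Fin d × Site d) => SideTouches (Ω j) t.2.2 t.2.1)
        (fun t => covDerivFwd η U₀ t.1 (fun z => A' z t.2.1) t.2.2)
        ≤ B₀ * (bondNorm L m η (-(3 : ℝ)) Ω (fun x μ => Jcur η U₀ A' μ x)
        + wsup 1 (fun p : {p : ℕ × (Site d × Fin d) // p.1 ≤ m ∧ p.2 ∈ Λb m p.1} =>
        linCovIter L U₀ (iEta η A') p.1.1 p.1.2.1 p.1.2.2)) + Sg) :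
    ∀ j, j ≤ m → ∀ (y : Site d) (κ τ : Fin d), SideTouches (Ω j) y τ →
      ((L : ℝ) ^ j * η) ^ 2 * ‖covDerivFwd η U₀ κ (fun z => A' z τ) y‖ ≤ 5 * d * L * B₀ * (α₀ + α₁) + 2 * Sg := by
  have hL1 : 1 ≤ L := le_trans (by norm_num) hL
  have hLr : (1 : ℝ) ≤ L := by exact_mod_cast hL1
  -- the (1.55) window `16α₂ ≤ 1` from the γ window `16·Lα₂ ≤ 1` (`L ≥ 1`)
  have h16 : 16 * α₂ ≤ 1 := by
    have h := mul_le_mul_of_nonneg_left hLr (show (0 : ℝ) ≤ 16 * α₂ by positivity)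
    linarith [h]
  have hU₀1 : ∀ x κ, U₀ x κ ∈ U1 𝔸 := fun x κ => unitaryUnits_le_U1 (hU₀ x κ)
  -- the datum is unitary-valued; its class (1.40)₁ by gauge invariance and locality
  have hWu : ∀ x κ, U₁ x κ ∈ unitaryUnits 𝔸 := mem_unitaryUnits_of_mgauge_eq hU₀ hU' hu₁ hW
  have h33m : InAk L m η α₀ Ω U₀ := fun j hj => h33 j (hj.trans hmK)
  have h34W : InAk L m η α₀ Ω (mulCfg U₁ U₀) := by
    have h1 : InAk L m η α₀ Ω (mulCfg U' U₀) := fun j hj => h34 j (hj.trans hmK)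
    have hui : ∀ x, u₁⁻¹ x ∈ U1 𝔸 := fun x => unitaryUnits_le_U1 ((unitaryUnits 𝔸).inv_mem (hu₁ x))
    rw [mulCfg_eq_gaugeAct_of_mgauge_eq hW]
    exact (B8Ineq132.inAk_gaugeAct_iff L m η α₀ Ω hui _).2 h1
  have h40₁ : InAk L m η α₀ Ω (mulCfg (expCfg (iEta η A')) U₀) := by
    refine (inAk_congr_of_sideTouches L m η α₀ (V := mulCfg U₁ U₀) fun j hj y τ hs => ?_).1 h34W
    show U₁ y τ * U₀ y τ = expCfg (iEta η A') y τ * U₀ y τ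
    rw [(hWA j hj y τ hs).1, expCfg_iEta_eq_cfgExp]
  have h41' : ∀ j, j ≤ m → ∀ (y : Site d) (τ : Fin d), SideTouches (Ω j) y τ → ‖A' y τ‖ ≤ α₂ * ((L : ℝ) ^ j * η)⁻¹ :=
    fun j hj y τ hs => (hWA j hj y τ hs).2
  -- the gradient datum (bounded family) and its supremum `g`
  have hgrad : ∀ (y : Site d) (κ τ : Fin d), ‖covDerivFwd η U₀ κ (fun z => A' z τ) y‖ ≤ 2 * α₂ * η⁻¹ * η⁻¹ := by
    intro y κ τ
    have h := grad_bound_trivial hη hL1 hU₀ hα₂.le h41' hA0 y κ τ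
    have hη2 : 0 < η ^ 2 := by positivity
    rw [show 2 * α₂ * η⁻¹ * η⁻¹ = 2 * α₂ / η ^ 2 by field_simp, le_div_iff₀ hη2, mul_comm]
    exact h
  have hBg : Bdd L m η (-(2 : ℝ)) (fun j (t : Fin d × Fin d × Site d) => SideTouches (Ω j) t.2.2 t.2.1)
      (fun t => covDerivFwd η U₀ t.1 (fun z => A' z t.2.1) t.2.2) := by
    have e2 : (-(2 : ℝ)) = -((2 : ℕ) : ℝ) := by norm_num
    rw [e2]
    refine B8ScaledSupNorm.bdd_of_forall (c := 2 * α₂ * ((L : ℝ) ^ m) ^ 2) fun j hj t _ => ?_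
    rw [B8ScaledSupNorm.weight_neg_natCast L η 2 j]
    have hLjm : (L : ℝ) ^ j ≤ (L : ℝ) ^ m := pow_le_pow_right₀ hLr hj
    have hLj0 : (0 : ℝ) ≤ (L : ℝ) ^ j := by positivity
    calc ((L : ℝ) ^ j * η) ^ 2 * ‖covDerivFwd η U₀ t.1 (fun z => A' z t.2.1) t.2.2‖
        ≤ ((L : ℝ) ^ j * η) ^ 2 * (2 * α₂ * η⁻¹ * η⁻¹) := mul_le_mul_of_nonneg_left (hgrad _ _ _) (by positivity)
      _ = 2 * α₂ * ((L : ℝ) ^ j) ^ 2 := by field_simp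
      _ ≤ 2 * α₂ * ((L : ℝ) ^ m) ^ 2 := by gcongr
  set g : ℝ := msup L m η (-(2 : ℝ)) (fun j (t : Fin d × Fin d × Site d) => SideTouches (Ω j) t.2.2 t.2.1)
      (fun t => covDerivFwd η U₀ t.1 (fun z => A' z t.2.1) t.2.2) with hg_def
  have hg0 : 0 ≤ g := B8ScaledSupNorm.msup_nonneg L m hη.le _ _ _
  have hg : ∀ j, j ≤ m → ∀ (y : Site d) (κ τ : Fin d), SideTouches (Ω j) y τ →
      ((L : ℝ) ^ j * η) ^ 2 * ‖covDerivFwd η U₀ κ (fun z => A' z τ) y‖ ≤ g := by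
    intro j hj y κ τ hs
    have h := B8ScaledSupNorm.weight_mul_norm_le_msup hBg hj (i := (κ, τ, y)) hs
    have hw : weight L η (-(2 : ℝ)) j = ((L : ℝ) ^ j * η) ^ 2 := by
      have e2 : (-(2 : ℝ)) = -((2 : ℕ) : ℝ) := by norm_num
      rw [e2, B8ScaledSupNorm.weight_neg_natCast L η 2 j]
    rw [hw] at h
    exact h
  -- (1.42)/(1.37) on the constraint bonds of the `m`-truncation, by the (1.42) lemma (it reads the gauge predicate `Lan` abstractly)
  have h42 : ∀ j, j ≤ m → ∀ c ∈ Λb m j, ‖logCovIter L U₀ (iEta η A') j c.1 c.2‖ < 2 * d * L * α₁ :=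
    B8Eq142KLevelLocalGamma.H42_of_inAx_γ hd2 hη hL K hU₀ hα₀ hα₁ hα₂.le hα3 hα4 h16L hsmall hc₃ hsmall₁ Ω hΩ Λs Λb hbox hclass h33 h34 hAx
      h135 Lan m hm1 hmK u₁ U₁ A' hu₁ hW h129 hLan hsa hWA hA0
  have hboxm : ∀ j, j ≤ m → ∀ c ∈ Λb m j, ∀ x, InBox (loK L j c.1) (bondHiK L j c.1 c.2) x → x ∈ Ω (j - 1) :=
    fun j hj c hc x hx => hbox m hmK j hj c hc x hx
  -- PROPOSITION 3 WITH SOURCE at `m` levels (n05-c g4's `prop3_normA_kLevel_src` over n05-b): the gradient member, `+ 2·Sg`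
  obtain ⟨-, hg'⟩ := B8Prop3GaugeFixedKLevelSrcGamma.prop3_normA_kLevel_src_γ hd2 hη hL hU₀ hsa hα₀ hα₁.le hα₂.le hg0 hα3 hα4 h16 hd5
    hsmall hc₃ hB₀
    hside h50 hC₂ h61 hboxm h33m h40₁ h41' hg h42 h59a h59g
  intro j hj y κ τ hs
  exact (hg j hj y κ τ hs).trans hg'

#print axioms grad_bound_of_datum_src_γ

end Grad

end Literature.MathematicalPhysics.QuantumFieldTheory.Balaban1983to89.B8Prop5SocketDatumSrcGamma

end
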